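import Summits.QuantumFields.YangMills.Theorems.BalabanUVNodesPortS1LZdetPiecesDefs

/-!
# NODE O port PT-A — THE INTEGER TWIN OF THE POWER MEMBER, AS A DISPLAYED STATEMENT `PowMemberIntTwin F` (v3.5 reshape of the glue `stub_LZdetGlue` of 27930, line `pta_residueW`:
# `stub_LZdetGlue` = ⟨this twin⟩ + a PROVED assembly; the twin is the one remaining P0-free brick of the Gaussian sub-half)

Cell `ym-nodeO-ideate`, porter seat `ymgap-nodeO-port-PTA-1` (gen 8); DEFINITION file (a statement the line posits), `--supports stmt-QuantumFields-27930`.  [I] = [Balaban1987RG1], [16] = [Balaban1985UV3].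
WHY.  The wrap-aware residue of ⁸ asks, besides the torus pieces `E n X` with rows (a)–(d), ONE window-local `SL(2,ℂ)`-invariant INTEGER formula `Ψ : IntLocalFormula (L^{k+1}·Mc)` whose pull-back
pieces ARE the torus pieces OFF the centred wrap class ((1.21) «T^{(j+1)} ↗ Z^d … by the localized representation (1.7)»).  For the Gaussian bracket's pieces
`E_X = [½∫₀^R EG_X + powMemberPiece_X](φ) − [same](𝟙)` the resolvent member's twin is HANDED OVER by `stub_G3C`'s (gZ) (`EGZ x`), and the unit subtraction is a constant; what remains is the
integer twin of the POWER MEMBER `powMemberPiece (Y ↦ Y) (Y ↦ nonB0Block (TY n Y φ)) R X` — a window-local invariant integer formula built from the P0-ℂ letter's integer pieces `TZY` ((Z-supp)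
(Z-dom)(Z-loc)(Z-cov)) that reads, through the cover and OFF the wrap class ((Z-bridge), ✓`coverAt_injOn_blockSites_intCubes`), exactly the torus power piece.  This file DISPLAYS that
statement; the companion proof file `…PortS1LZdetAssembly` proves `PowMemberIntTwin F → P0HolExtAtRecordG[L] F → G3CAtRecord[L] F → PortRecordLZdetHalf F`.
* `PowMemberIntTwin (F : T4Family) : Prop` — for every admissible cube size, every datum of the P0-ℂ body `P0CarrierClauses …` and every radius `R`, there is
  `ΨP : IntLocalFormula (F.L^{k+1}·Mc)` with `ΨP.piece … X φ = powMemberPiece … R X` for every volume `recordK₀ + n`, every `X ∉ recordWrapCtr`, every pair `φ`.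

HONEST FRAMING.  A DISPLAYED statement (Prop-valued; a predicate in `F`), asserted for nothing and proved nowhere yet (porter's estimate: M–L, P0-free torus∕integer bookkeeping — the (63)
power series transported along the bijection «torus domains `Y ⊆ X`» ↔ «face-connected integer cube sets `Ŷ ⊆ X̂_K(X)`» and the index bijection `b̂ ↦ π_k b̂` on non-central bonds);
`stub_P0C` ∕ `stub_G3C` ∕ `stub_LZdetGlue` ∕ `stub_FE` OPEN; 27930 OPEN (2∕6 stubs by name) · no claim; NODE O 0∕1; COUNT 8∕28 · K 1∕4 UNMOVED; finite `𝕋⁴_{L^K}` at fixed ε — NOT continuum ∕ OS ∕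
Clay; **the Yang–Mills mass gap is NOT proved by any of this.**  No `sorry`, no `instance`, no `notation`; standard axioms.
-/

noncomputable section

open scoped BigOperators Matrix.Norms.L2Operator

namespace Summit.QuantumFields.YangMills.Theorems.BalabanUVNodesPortS1

open Summit.QuantumFields.YangMills.Theorems.K0RecordFormatNames
open Literature.MathematicalPhysics.QuantumFieldTheory.Balaban1983to89
open Literature.MathematicalPhysics.QuantumFieldTheory.Balaban1983to89.Node00
open Literature.MathematicalPhysics.QuantumFieldTheory.Balaban1983to89.T4Continuum (T4Family)
open Literature.MathematicalPhysics.QuantumFieldTheory.Balaban1983to89.TreeLengthTorus (TPt)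

open scoped Classical in
/-- ★★ **`PowMemberIntTwin F` — THE INTEGER TWIN OF THE POWER MEMBER OF [16] (63), AS A STATEMENT**: for every admissible cube size `Mc` (`McGuard`), every datum
`(a₀, δ₀, c₀, γ₀, γ₁, α₀, α₁, ε₂₉, k, TC, TY, TZY, AdM, AdZ)` of the P0-ℂ body `P0CarrierClauses …` and every radius `R`, there is ONE window-local `SL(2,ℂ)`-invariant integer formula
`ΨP : IntLocalFormula (F.L^{k+1}·Mc)` whose pull-back piece at every volume `recordK₀ F Mc k + n`, every domain `X` OFF the centred wrap class and every pair `φ` IS the torus power piece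
`powMemberPiece (Y ↦ Y) (Y ↦ nonB0Block (TY n Y φ)) R X` (print's (1.21) volume independence of the (63) power members, through the localized representation (1.7)).  DISPLAYED; proved nowhere yet.
[cite: Balaban1987RG1, (1.21) p.264, (1.7) p.261, (1.19) p.263; Balaban1985UV3, (63) p.272] -/
def PowMemberIntTwin (F : T4Family) : Prop :=
  ∀ (Mc : ℕ), McGuard F Mc → ∀ (a₀ δ₀ c₀ γ₀ γ₁ α₀ α₁ ε₂₉ : ℝ) (k : ℕ)
    (TC : (n : ℕ) → Sect2.CPair (F.P (recordK₀ F Mc k + n)) (MatA 2) →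
        FluctIdx F k (recordK₀ F Mc k + n) → FluctIdx F k (recordK₀ F Mc k + n) → ℂ)
    (TY : (n : ℕ) → (recordDomSys F Mc k (recordK₀ F Mc k + n)).Dom → Sect2.CPair (F.P (recordK₀ F Mc k + n)) (MatA 2) →
        FluctIdx F k (recordK₀ F Mc k + n) → FluctIdx F k (recordK₀ F Mc k + n) → ℂ)
    (TZY : Finset (Fin 4 → ℤ) → IntBondCfg → ((Fin 4 → ℤ) × Fin 4) × Fin 3 → ((Fin 4 → ℤ) × Fin 4) × Fin 3 → ℂ)
    (AdM : (n : ℕ) → (Site (F.P (recordK₀ F Mc k + n)) 0 → (MatA 2)ˣ) →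
        Matrix (FluctIdx F k (recordK₀ F Mc k + n)) (FluctIdx F k (recordK₀ F Mc k + n)) ℂ)
    (AdZ : ((Fin 4 → ℤ) → (MatA 2)ˣ) → (Fin 4 → ℤ) × Fin 4 → Matrix (Fin 3) (Fin 3) ℂ),
    P0CarrierClauses F a₀ δ₀ c₀ γ₀ γ₁ Mc α₀ α₁ ε₂₉ k TC TY TZY AdM AdZ →
    ∀ R : ℝ, ∃ ΨP : IntLocalFormula (F.L ^ (k + 1) * Mc),
      ∀ (n : ℕ) (X : (recordDomSys F Mc k (recordK₀ F Mc k + n)).Dom), X ∉ recordWrapCtr F Mc k (recordK₀ F Mc k + n) →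
        ∀ φ : Sect2.CPair (F.P (recordK₀ F Mc k + n)) (MatA 2),
          ΨP.Ψ.piece F Mc k (recordK₀ F Mc k + n) X φ =
            powMemberPiece (fun Y : (recordDomSys F Mc k (recordK₀ F Mc k + n)).Dom =>
                (Y.1 : Finset (TPt (F.P (recordK₀ F Mc k + n)).d (Sect2.domCount (F.P (recordK₀ F Mc k + n)) Mc (k + 1)))))
              (fun Y => nonB0Block F k (recordK₀ F Mc k + n) (TY n Y φ)) R X.1

end Summit.QuantumFields.YangMills.Theorems.BalabanUVNodesPortS1

end
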